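import Mathlib
import Summits.CriticalPhenomena.CardyFormulaZ2.Theorems.CardyMagicRigidityNestingRigidityLatticeDustT
import Summits.CriticalPhenomena.CardyFormulaZ2.Theorems.CardyMagicRigidityNestingRigidityLatticeDustZ2
import Summits.CriticalPhenomena.CardyFormulaZ2.Theorems.CardyMagicRigidityNestingRigiditySoftMachineTameAssemblyDust
import HarnessLib

/-!
# Lattice dust density (Dlat) of both lattice ensembles: `latticeDust_latticeEnsembles`

Crux `Summit.CriticalPhenomena.CardyFormulaZ2.Theses.CardyMagicRigidity.NestingRigidity`
(stmt-CriticalPhenomena-4835), line `positive-cone-weight-doubling`, registered stub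
`latticeDust_latticeEnsembles`: for `E ∈ latticeEnsembles = {zEns, tEns}`, every window radius `R`,
radius `r > 0` and `κ > 0` there is `d > 0` such that for all small meshes `δ`, off an event of
probability `≤ κ`, every disc `B(z, r')` with `z ∈ B̄(0, R)` and `r' ≥ r/2` contains a member of EACH
type of `E.X δ ω` of diameter `≥ d` — verbatim the lattice hypothesis (Dlat) of
`tamePrecompact_tEns_of_ae_tame_separating_of_latticeDust` /
`tamePrecompact_zEns_of_traversalBound_of_ae_tame_separating_of_latticeDust` (…SoftMachineTameAssemblyDust;
the two `example`s at the end feed it in).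

Assembly (`latticeDust_of_local`, pure bookkeeping): cover `B̄(0, R)` by finitely many balls
`B(y, r/4)` (`finite_cover_balls_of_compact`), apply the LOCAL dust densities `latticeDust_local_tEns`
(…LatticeDustT: RSW circuit triples on `𝕋` + outer boundaries of finite clusters) and
`latticeDust_local_zEns` (…LatticeDustZ2: RSW crossings / blocked annuli on `ℤ²`, translation,
self-duality) at each centre with `κ/(#net + 1)`, and take the union of the exceptional events.
-/

noncomputable section

open MeasureTheory Set Filter Metric TopologicalSpace Function
open scoped Topology ENNReal NNReal unitInterval

namespace Summit.CriticalPhenomena.CardyFormulaZ2.Cruxes.NestingRigidity.PositiveConeWeightDoubling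

open Literature.Probability.RandomPlanarGeometry Literature.Probability.Percolation
  Literature.Probability.LatticeModels
open Summit.CriticalPhenomena.CardyFormulaZ2.Cruxes.NestingRigidity.RingCloudTomography

/-- **From the local dust density to the windowed one** (any mesh-indexed ensemble): if for every
`ρ, κ > 0` there is `d > 0` such that for small `δ` and every centre `y`, off an event of probability
`≤ κ`, `B(y, ρ)` contains a member of each type of diameter `≥ d`, then the dust density (Dlat) holds on
every window `B̄(0, R)` (finite `r/4`-net of the window, union bound). -/
theorem latticeDust_of_local (E : LoopEnsemble)
    (hloc : ∀ (ρ κ : ℝ), 0 < ρ → 0 < κ → ∃ d : ℝ, 0 < d ∧ ∀ᶠ δ in 𝓝[>] (0 : ℝ), ∀ y : ℂ,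
      ∃ G : Set E.Ω, MeasurableSet G ∧ E.P Gᶜ ≤ ENNReal.ofReal κ ∧
        ∀ ω ∈ G, ∀ i : Fin 2, ∃ v ∈ (E.X δ ω).F i, v.range ⊆ ball y ρ ∧ d ≤ diam v.range) :
    ∀ (R r κ : ℝ), 0 < r → 0 < κ → ∃ d : ℝ, 0 < d ∧ ∀ᶠ δ in 𝓝[>] (0 : ℝ),
      ∃ Fev : Set E.Ω, MeasurableSet Fev ∧ E.P Fev ≤ ENNReal.ofReal κ ∧
        ∀ ω ∉ Fev, ∀ z ∈ closedBall (0 : ℂ) R, ∀ i : Fin 2, ∀ r' : ℝ, r / 2 ≤ r' →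
          ∃ v ∈ (E.X δ ω).F i, v.range ⊆ ball z r' ∧ d ≤ diam v.range := by
  intro R r κ hr hκ
  obtain ⟨t, -, htfin, hcover⟩ :=
    finite_cover_balls_of_compact (isCompact_closedBall (0 : ℂ) R) (show 0 < r / 4 by positivity)
  set N : ℕ := htfin.toFinset.card with hN
  obtain ⟨d, hd, hev⟩ := hloc (r / 4) (κ / (N + 1)) (by positivity) (by positivity)
  refine ⟨d, hd, ?_⟩
  filter_upwards [hev] with δ hδ
  choose G hGm hGP hGdet using hδ
  refine ⟨⋃ y ∈ htfin.toFinset, (G y)ᶜ, Finset.measurableSet_biUnion _ fun y _ ↦ (hGm y).compl, ?_, ?_⟩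
  · have hκN : (N : ℝ) * (κ / (N + 1)) ≤ κ := by
      rw [mul_div_assoc', div_le_iff₀ (by positivity)]; nlinarith
    calc E.P (⋃ y ∈ htfin.toFinset, (G y)ᶜ) ≤ ∑ y ∈ htfin.toFinset, E.P (G y)ᶜ :=
          measure_biUnion_finset_le _ _
      _ ≤ ∑ _y ∈ htfin.toFinset, ENNReal.ofReal (κ / (N + 1)) := Finset.sum_le_sum fun y _ ↦ hGP y
      _ = ENNReal.ofReal (N * (κ / (N + 1))) := by
          rw [Finset.sum_const, nsmul_eq_mul, ENNReal.ofReal_mul (Nat.cast_nonneg _), ENNReal.ofReal_natCast]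
      _ ≤ ENNReal.ofReal κ := ENNReal.ofReal_le_ofReal hκN
  · intro ω hω z hz i r' hr'
    have hz' := hcover hz
    rw [mem_iUnion₂] at hz'
    obtain ⟨y, hyt, hzy⟩ := hz'
    have hωy : ω ∈ G y := by
      by_contra h
      exact hω (mem_iUnion₂.2 ⟨y, htfin.mem_toFinset.2 hyt, h⟩)
    obtain ⟨v, hv, hvr, hvd⟩ := hGdet y ω hωy i
    refine ⟨v, hv, hvr.trans fun w hw ↦ ?_, hvd⟩
    rw [mem_ball] at hw hzy ⊢
    linarith [dist_triangle w y z, dist_comm z y]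

/-- **Registered stub `latticeDust_latticeEnsembles` — the lattice dust density (Dlat) of both lattice
ensembles.**  For `E ∈ latticeEnsembles`, every `R`, `r > 0` and `κ > 0` there is `d > 0` such that for
all small meshes `δ`, off a measurable event of probability `≤ κ`, every disc `B(z, r')`, `z ∈ B̄(0, R)`,
`r' ≥ r/2`, contains a member of each type `i` of `E.X δ ω` of diameter `≥ d` (mesoscopic loops of BOTH
types are dense).  Pure RSW on both lattices: `latticeDust_local_zEns`, `latticeDust_local_tEns`,
assembled by `latticeDust_of_local`. -/
theorem latticeDust_latticeEnsembles : ∀ E ∈ latticeEnsembles,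
    ∀ (R r κ : ℝ), 0 < r → 0 < κ → ∃ d : ℝ, 0 < d ∧ ∀ᶠ δ in 𝓝[>] (0 : ℝ),
      ∃ Fev : Set E.Ω, MeasurableSet Fev ∧ E.P Fev ≤ ENNReal.ofReal κ ∧
        ∀ ω ∉ Fev, ∀ z ∈ closedBall (0 : ℂ) R, ∀ i : Fin 2, ∀ r' : ℝ, r / 2 ≤ r' →
          ∃ v ∈ (E.X δ ω).F i, v.range ⊆ ball z r' ∧ d ≤ diam v.range := by
  intro E hE
  rcases hE with rfl | rfl
  · exact latticeDust_of_local zEns latticeDust_local_zEns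
  · exact latticeDust_of_local tEns latticeDust_local_tEns

-- The `tEns` instance is verbatim the lattice hypothesis (Dlat) of
-- `tamePrecompact_tEns_of_ae_tame_separating_of_latticeDust` (…SoftMachineTameAssemblyDust):
example := fun hfields ↦
  tamePrecompact_tEns_of_ae_tame_separating_of_latticeDust hfields (latticeDust_latticeEnsembles tEns tEns_mem)

-- The `zEns` instance is verbatim the lattice hypothesis (Dlat) of
-- `tamePrecompact_zEns_of_traversalBound_of_ae_tame_separating_of_latticeDust`:
example := fun hH1 hfields ↦
  tamePrecompact_zEns_of_traversalBound_of_ae_tame_separating_of_latticeDust hH1 hfields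
    (latticeDust_latticeEnsembles zEns zEns_mem)

end Summit.CriticalPhenomena.CardyFormulaZ2.Cruxes.NestingRigidity.PositiveConeWeightDoubling

end
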